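import Mathlib.MeasureTheory.Integral.RieszMarkovKakutani.Real
import Mathlib.Algebra.Module.Rat
import Mathlib.Analysis.SpecificLimits.Basic
import HarnessLib

/-!
# Riesz–Markov representation of positive `ℚ`-linear functionals on a dominated-dense test family

Topic `Literature/Probability/Distributions`; model-free bookkeeping written for the
Riesz–Markov step of the Garban–Pete–Schramm pivotal-kernel limit of lattice models (route
`Summits/CriticalPhenomena/CardyFormulaZ2/Theses/CardyMeckeFlip`, crux `FlipErgodicityZ2`, stub
"joint multi-cutoff pivotal-kernel limit with a measurable kernel"): a joint limit in law only
sees COUNTABLY many test functions, so the limit functionals `f ↦ T f` are a priori defined,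
additive, `ℚ`-homogeneous and positive only on a countable family `𝓓 ⊆ C_c(Y, ℝ)` which is
closed under `+` and rational multiples and *dominated-dense*: every compact `K` has a cutoff
`χ ∈ 𝓓`, `0 ≤ χ ≤ 1`, `χ = 1` on `K`, such that every `f ∈ C_c` supported in `K` is, for every
`η > 0`, within `η χ` of some `g ∈ 𝓓` (such a `𝓓` exists on every second countable locally compact
regular space: `exists_countable_dominatedDense` in `CountableTestFamily.lean`; here `𝓓` and its
three properties are HYPOTHESES, stated verbatim as there).

**Results** (`Y` a topological space; for the measure statements locally compact `T2` Borel):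
* `testFunctional_mono`, `testFunctional_abs_sub_le` — a functional `T` additive, `ℚ`-homogeneous
  and positive on `𝓓` is monotone on `𝓓` and `|T g - T g'| ≤ η T χ` whenever `|g - g'| ≤ η χ`
  (`g, g', χ ∈ 𝓓`, `χ ≥ 0`);
* `exists_positiveLinearMap_of_additive_of_nonneg` — an additive functional on `C_c(Y, ℝ)` which
  is non-negative on non-negative functions is a positive `ℝ`-LINEAR map (real homogeneity is
  automatic: squeeze between rational multiples of `|f|`);
* `exists_positiveLinearMap_eq_on_dominatedDense` — such a `T` agrees on `𝓓` with a positive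
  linear functional `Λ` on `C_c(Y, ℝ)` (extension by dominated density: the `T`-values of
  dominated approximants are Cauchy);
* `exists_regular_measure_integral_eq_on_dominatedDense` — hence (Mathlib's real
  Riesz–Markov–Kakutani theorem `RealRMK.integral_rieszMeasure`) there is a regular Borel measure
  `m`, finite on compact sets, with `∫ f dm = T f` for all `f ∈ 𝓓`.

No named fact, no new definition; Mathlib only.  NOT here (see `RieszMarkovKernelMeasurable.lean`):
the domination estimate for integrals and the uniqueness of `m`, the kernel (measurable-family)
version and its a.e. bookkeeping; also not here: vague topology, signed functionals.

## References

* W. Rudin, *Real and Complex Analysis*, 3rd ed. (1987), Thm. 2.14 (Riesz representation of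
  positive linear functionals on `C_c`). [Rudin1987]
* The extension of a positive additive functional from a dominated-dense `ℚ`-subspace is
  standard (Daniell-type extension); no single source. [folklore]
-/

noncomputable section

open Set Filter Function
open _root_.MeasureTheory _root_.Topology
open scoped CompactlySupported

namespace Literature.Probability.Distributions

variable {Y : Type*} [TopologicalSpace Y]

section TestFunctional

variable {𝓓 : Set C_c(Y, ℝ)} {T : C_c(Y, ℝ) → ℝ}
  (hadd : ∀ f ∈ 𝓓, ∀ g ∈ 𝓓, f + g ∈ 𝓓) (hsmul : ∀ (q : ℚ), ∀ f ∈ 𝓓, (q : ℝ) • f ∈ 𝓓)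
  (hTadd : ∀ f ∈ 𝓓, ∀ g ∈ 𝓓, T (f + g) = T f + T g)
  (hThom : ∀ (q : ℚ), ∀ f ∈ 𝓓, T ((q : ℝ) • f) = (q : ℝ) * T f)
  (hTpos : ∀ f ∈ 𝓓, (∀ x, 0 ≤ f x) → 0 ≤ T f)

include hadd hsmul in
/-- A subset of `C_c(Y, ℝ)` closed under `+` and under rational multiples is closed under
subtraction (`f - g = f + (-1 : ℚ) • g`). [folklore] -/
theorem sub_mem_of_ratStable {f g : C_c(Y, ℝ)} (hf : f ∈ 𝓓) (hg : g ∈ 𝓓) : f - g ∈ 𝓓 := by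
  have h : f - g = f + ((-1 : ℚ) : ℝ) • g := by
    ext x
    simp only [CompactlySupportedContinuousMap.sub_apply, CompactlySupportedContinuousMap.add_apply,
      CompactlySupportedContinuousMap.smul_apply, smul_eq_mul, Rat.cast_neg, Rat.cast_one]
    ring
  rw [h]
  exact hadd f hf _ (hsmul (-1) g hg)

include hsmul hTadd hThom in
/-- A functional additive and `ℚ`-homogeneous on a rationally stable `𝓓` is subtractive on `𝓓`.
[folklore] -/
theorem testFunctional_sub {f g : C_c(Y, ℝ)} (hf : f ∈ 𝓓) (hg : g ∈ 𝓓) :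
    T (f - g) = T f - T g := by
  have h : f - g = f + ((-1 : ℚ) : ℝ) • g := by
    ext x
    simp only [CompactlySupportedContinuousMap.sub_apply, CompactlySupportedContinuousMap.add_apply,
      CompactlySupportedContinuousMap.smul_apply, smul_eq_mul, Rat.cast_neg, Rat.cast_one]
    ring
  rw [h, hTadd f hf _ (hsmul (-1) g hg), hThom (-1) g hg]
  push_cast
  ring

include hadd hsmul hTadd hThom hTpos in
/-- **Monotonicity on the test family.**  A functional additive, `ℚ`-homogeneous and positive
on a rationally stable `𝓓 ⊆ C_c(Y, ℝ)` is monotone on `𝓓`: `f ≤ g` pointwise implies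
`T f ≤ T g` (apply positivity to `g - f ∈ 𝓓`). [folklore] -/
theorem testFunctional_mono {f g : C_c(Y, ℝ)} (hf : f ∈ 𝓓) (hg : g ∈ 𝓓) (hle : ∀ x, f x ≤ g x) :
    T f ≤ T g := by
  have h := hTpos (g - f) (sub_mem_of_ratStable hadd hsmul hg hf) fun x => by
    simpa only [CompactlySupportedContinuousMap.sub_apply, sub_nonneg] using hle x
  rw [testFunctional_sub hsmul hTadd hThom hg hf] at h
  linarith

include hadd hsmul hTadd hThom hTpos in
/-- **Domination estimate on the test family.**  If `T` is additive, `ℚ`-homogeneous and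
positive on a rationally stable `𝓓`, and `g, g', χ ∈ 𝓓` with `χ ≥ 0` satisfy
`|g x - g' x| ≤ η * χ x` for all `x`, then `|T g - T g'| ≤ η * T χ` (for rational `q ≥ η`
compare `g` with `g' + q χ ∈ 𝓓` and `g'` with `g + q χ ∈ 𝓓`, then let `q ↓ η`). [folklore] -/
theorem testFunctional_abs_sub_le {g g' χ : C_c(Y, ℝ)} (hg : g ∈ 𝓓) (hg' : g' ∈ 𝓓) (hχ : χ ∈ 𝓓)
    (hχ0 : ∀ x, 0 ≤ χ x) {η : ℝ} (h : ∀ x, |g x - g' x| ≤ η * χ x) : |T g - T g'| ≤ η * T χ := by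
  -- rational coefficients first
  have hrat : ∀ q : ℚ, η ≤ q → |T g - T g'| ≤ q * T χ := by
    intro q hq
    have hb : ∀ x, |g x - g' x| ≤ (q : ℝ) * χ x := fun x =>
      (h x).trans (mul_le_mul_of_nonneg_right hq (hχ0 x))
    have hmem : ∀ {u : C_c(Y, ℝ)}, u ∈ 𝓓 → u + (q : ℝ) • χ ∈ 𝓓 := fun hu =>
      hadd _ hu _ (hsmul q χ hχ)
    have hT : ∀ {u : C_c(Y, ℝ)}, u ∈ 𝓓 → T (u + (q : ℝ) • χ) = T u + q * T χ := fun hu => by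
      rw [hTadd _ hu _ (hsmul q χ hχ), hThom q χ hχ]
    have h1 : T g ≤ T g' + q * T χ := by
      rw [← hT hg']
      refine testFunctional_mono hadd hsmul hTadd hThom hTpos hg (hmem hg') fun x => ?_
      have hx := (abs_le.mp (hb x)).2
      simp only [CompactlySupportedContinuousMap.add_apply,
        CompactlySupportedContinuousMap.smul_apply, smul_eq_mul]
      linarith
    have h2 : T g' ≤ T g + q * T χ := by
      rw [← hT hg]
      refine testFunctional_mono hadd hsmul hTadd hThom hTpos hg' (hmem hg) fun x => ?_
      have hx := (abs_le.mp (hb x)).1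
      simp only [CompactlySupportedContinuousMap.add_apply,
        CompactlySupportedContinuousMap.smul_apply, smul_eq_mul]
      linarith
    exact abs_sub_le_iff.mpr ⟨by linarith, by linarith⟩
  -- then let `q ↓ η`
  have hTχ : 0 ≤ T χ := hTpos χ hχ hχ0
  refine le_of_forall_pos_le_add fun δ hδ => ?_
  have hpos : 0 < δ / (T χ + 1) := div_pos hδ (by linarith)
  obtain ⟨q, hq1, hq2⟩ := exists_rat_btwn (show η < η + δ / (T χ + 1) by linarith)
  calc |T g - T g'| ≤ q * T χ := hrat q hq1.le
    _ ≤ (η + δ / (T χ + 1)) * T χ := mul_le_mul_of_nonneg_right hq2.le hTχ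
    _ = η * T χ + δ * (T χ / (T χ + 1)) := by ring
    _ ≤ η * T χ + δ * 1 := by
        gcongr
        exact (div_le_one (by linarith)).mpr (by linarith)
    _ = η * T χ + δ := by ring

end TestFunctional

section Linear

/-- **Additive non-negative functionals on `C_c` are positive linear maps.**  If
`Λ₀ : C_c(Y, ℝ) → ℝ` is additive and `Λ₀ f ≥ 0` whenever `f ≥ 0`, then `Λ₀` is (the underlying
function of) a positive `ℝ`-linear map: additivity gives `ℚ`-homogeneity, and for real `c` and
rational `q`, `r` with `|c - q| ≤ r` monotonicity gives
`|Λ₀ (c • f) - c Λ₀ f| = |Λ₀ ((c - q) • f) - (c - q) Λ₀ f| ≤ r (Λ₀ |f| + |Λ₀ f|)`. [folklore] -/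
theorem exists_positiveLinearMap_of_additive_of_nonneg (Λ₀ : C_c(Y, ℝ) → ℝ)
    (hadd : ∀ f g, Λ₀ (f + g) = Λ₀ f + Λ₀ g) (hpos : ∀ f, (∀ x, 0 ≤ f x) → 0 ≤ Λ₀ f) :
    ∃ Λ : C_c(Y, ℝ) →ₚ[ℝ] ℝ, ∀ f, Λ f = Λ₀ f := by
  let A : C_c(Y, ℝ) →+ ℝ := AddMonoidHom.mk' Λ₀ hadd
  have hA : ∀ f, A f = Λ₀ f := fun f => rfl
  have hmono : ∀ f g : C_c(Y, ℝ), (∀ x, f x ≤ g x) → Λ₀ f ≤ Λ₀ g := fun f g hfg => by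
    have h := hpos (g - f) fun x => by
      simpa only [CompactlySupportedContinuousMap.sub_apply, sub_nonneg] using hfg x
    have h' : Λ₀ g = Λ₀ (g - f) + Λ₀ f := by rw [← hadd, sub_add_cancel]
    linarith
  have hneg : ∀ f, Λ₀ (-f) = -Λ₀ f := fun f => by
    have h := map_neg A f
    rwa [hA, hA] at h
  have hrat : ∀ (q : ℚ) (f : C_c(Y, ℝ)), Λ₀ ((q : ℝ) • f) = (q : ℝ) * Λ₀ f := fun q f => by
    have h := map_ratCast_smul A ℝ ℝ q f
    simpa only [hA, smul_eq_mul] using h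
  have hsmul : ∀ (c : ℝ) (f : C_c(Y, ℝ)), Λ₀ (c • f) = c * Λ₀ f := by
    intro c f
    -- `F = |f|`
    set F : C_c(Y, ℝ) := f ⊔ -f with hF
    have hF0 : ∀ x, F x = |f x| := fun x => rfl
    have hFnn : 0 ≤ Λ₀ F := hpos F fun x => by rw [hF0]; exact abs_nonneg _
    -- `|Λ₀ (t • f)| ≤ r * Λ₀ F` for rational `r ≥ |t|`
    have hbd : ∀ (t : ℝ) (r : ℚ), |t| ≤ r → |Λ₀ (t • f)| ≤ r * Λ₀ F := fun t r htr => by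
      rw [← hrat]
      have hpt : ∀ x, |t * f x| ≤ ((r : ℝ) • F) x := fun x => by
        rw [CompactlySupportedContinuousMap.smul_apply, smul_eq_mul, hF0, abs_mul]
        exact mul_le_mul_of_nonneg_right htr (abs_nonneg _)
      have h1 : Λ₀ (t • f) ≤ Λ₀ ((r : ℝ) • F) := hmono _ _ fun x => by
        rw [CompactlySupportedContinuousMap.smul_apply, smul_eq_mul]
        exact (le_abs_self _).trans (hpt x)
      have h2 : Λ₀ (-(t • f)) ≤ Λ₀ ((r : ℝ) • F) := hmono _ _ fun x => by
        rw [CompactlySupportedContinuousMap.neg_apply, CompactlySupportedContinuousMap.smul_apply,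
          smul_eq_mul]
        exact (neg_le_abs _).trans (hpt x)
      rw [hneg] at h2
      exact abs_le.mpr ⟨by linarith, h1⟩
    -- `|Λ₀ (c • f) - c * Λ₀ f| ≤ r * (Λ₀ F + |Λ₀ f|)` for every rational `r > 0`
    have hmain : ∀ r : ℚ, 0 < r → |Λ₀ (c • f) - c * Λ₀ f| ≤ r * (Λ₀ F + |Λ₀ f|) := by
      intro r hr
      have hr' : (0 : ℝ) < r := by exact_mod_cast hr
      obtain ⟨q, hq1, hq2⟩ := exists_rat_btwn (show c - r < c + r by linarith)
      have hcq : |c - q| ≤ r := abs_sub_le_iff.mpr ⟨by linarith, by linarith⟩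
      have hsplit : Λ₀ (c • f) = Λ₀ ((c - q) • f) + q * Λ₀ f := by
        rw [← hrat, ← hadd]
        congr 1
        ext x
        simp only [CompactlySupportedContinuousMap.add_apply,
          CompactlySupportedContinuousMap.smul_apply, smul_eq_mul]
        ring
      rw [hsplit]
      calc |Λ₀ ((c - ↑q) • f) + ↑q * Λ₀ f - c * Λ₀ f|
          = |Λ₀ ((c - q) • f) - (c - q) * Λ₀ f| := by congr 1; ring
        _ ≤ |Λ₀ ((c - q) • f)| + |(c - q) * Λ₀ f| := abs_sub _ _
        _ ≤ r * Λ₀ F + r * |Λ₀ f| := by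
            refine add_le_add (hbd (c - q) r hcq) ?_
            rw [abs_mul]
            exact mul_le_mul_of_nonneg_right hcq (abs_nonneg _)
        _ = r * (Λ₀ F + |Λ₀ f|) := by ring
    -- conclude
    have hB : 0 ≤ Λ₀ F + |Λ₀ f| := add_nonneg hFnn (abs_nonneg _)
    have hle : |Λ₀ (c • f) - c * Λ₀ f| ≤ 0 := by
      refine le_of_forall_pos_le_add fun ε hε => ?_
      obtain ⟨r, hr0, hr1⟩ :=
        exists_rat_btwn (div_pos hε (by linarith : (0 : ℝ) < Λ₀ F + |Λ₀ f| + 1))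
      have hr0' : (0 : ℚ) < r := by exact_mod_cast hr0
      calc |Λ₀ (c • f) - c * Λ₀ f| ≤ r * (Λ₀ F + |Λ₀ f|) := hmain r hr0'
        _ ≤ ε / (Λ₀ F + |Λ₀ f| + 1) * (Λ₀ F + |Λ₀ f|) := mul_le_mul_of_nonneg_right hr1.le hB
        _ = ε * ((Λ₀ F + |Λ₀ f|) / (Λ₀ F + |Λ₀ f| + 1)) := by ring
        _ ≤ ε * 1 := by
            gcongr
            exact (div_le_one (by linarith)).mpr (by linarith)
        _ = 0 + ε := by ring
    have h0 : Λ₀ (c • f) - c * Λ₀ f = 0 := abs_nonpos_iff.mp hle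
    linarith
  refine ⟨PositiveLinearMap.mk₀ ⟨⟨Λ₀, hadd⟩, fun c f => by simpa using hsmul c f⟩ fun f hf => ?_,
    fun f => rfl⟩
  exact hpos f fun x => by simpa using hf x

end Linear

section Extension

variable {𝓓 : Set C_c(Y, ℝ)} {T : C_c(Y, ℝ) → ℝ}

/-- **Extension by dominated density.**  Let `𝓓 ⊆ C_c(Y, ℝ)` be closed under `+` and rational
multiples and dominated-dense (every compact `K` has a cutoff `χ ∈ 𝓓`, `0 ≤ χ ≤ 1`, `χ = 1` on
`K`, with every `f` supported in `K` within `η χ` of `𝓓` for every `η > 0`), and let `T` be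
additive, `ℚ`-homogeneous and positive on `𝓓`.  Then some positive linear functional `Λ` on
`C_c(Y, ℝ)` agrees with `T` on `𝓓`.  Proof: for `f ∈ C_c` pick `gₙ ∈ 𝓓` with
`|f - gₙ| ≤ χ / (n + 1)`; by `testFunctional_abs_sub_le` the values `T gₙ` are Cauchy, their
limit `Λ₀ f` does not depend on the approximating sequence, is additive and non-negative on
non-negative `f`, hence positive linear (`exists_positiveLinearMap_of_additive_of_nonneg`).
[folklore] -/
theorem exists_positiveLinearMap_eq_on_dominatedDense
    (hadd : ∀ f ∈ 𝓓, ∀ g ∈ 𝓓, f + g ∈ 𝓓) (hsmul : ∀ (q : ℚ), ∀ f ∈ 𝓓, (q : ℝ) • f ∈ 𝓓)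
    (hdense : ∀ K : Set Y, IsCompact K → ∃ χ ∈ 𝓓, (∀ x, χ x ∈ Icc (0 : ℝ) 1) ∧ (∀ x ∈ K, χ x = 1) ∧
      ∀ f : C_c(Y, ℝ), support f ⊆ K → ∀ η : ℝ, 0 < η → ∃ g ∈ 𝓓, ∀ x, |f x - g x| ≤ η * χ x)
    (hTadd : ∀ f ∈ 𝓓, ∀ g ∈ 𝓓, T (f + g) = T f + T g)
    (hThom : ∀ (q : ℚ), ∀ f ∈ 𝓓, T ((q : ℝ) • f) = (q : ℝ) * T f)
    (hTpos : ∀ f ∈ 𝓓, (∀ x, 0 ≤ f x) → 0 ≤ T f) :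
    ∃ Λ : C_c(Y, ℝ) →ₚ[ℝ] ℝ, ∀ f ∈ 𝓓, Λ f = T f := by
  -- the basic estimate, and `e n = 1 / (n + 1) → 0`
  have hest := fun {g g' χ : C_c(Y, ℝ)} (hg : g ∈ 𝓓) (hg' : g' ∈ 𝓓) (hχ : χ ∈ 𝓓) =>
    testFunctional_abs_sub_le hadd hsmul hTadd hThom hTpos (g := g) (g' := g') (χ := χ) hg hg' hχ
  have he0 : Tendsto (fun n : ℕ => 1 / ((n : ℝ) + 1)) atTop (𝓝 0) :=
    tendsto_one_div_add_atTop_nhds_zero_nat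
  have he_anti : ∀ {N n : ℕ}, N ≤ n → 1 / ((n : ℝ) + 1) ≤ 1 / ((N : ℝ) + 1) := fun {N n} h =>
    one_div_le_one_div_of_le (by positivity) (by exact_mod_cast Nat.add_le_add_right h 1)
  -- canonical dominated approximants `g f n ∈ 𝓓`, `|f - g f n| ≤ χ f / (n + 1)`
  have key : ∀ f : C_c(Y, ℝ), ∃ χ ∈ 𝓓, (∀ x, 0 ≤ χ x) ∧ ∃ g : ℕ → C_c(Y, ℝ), (∀ n, g n ∈ 𝓓) ∧
      ∀ n x, |f x - g n x| ≤ 1 / ((n : ℝ) + 1) * χ x := by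
    intro f
    obtain ⟨χ, hχ, h01, -, happrox⟩ := hdense (tsupport f) f.hasCompactSupport
    choose g hg hfg using fun n : ℕ =>
      happrox f (subset_tsupport _) (1 / ((n : ℝ) + 1)) (by positivity)
    exact ⟨χ, hχ, fun x => (h01 x).1, g, hg, hfg⟩
  choose χ hχ hχ0 g hg hfg using key
  -- the `T`-values of the approximants are Cauchy
  have hcauchy : ∀ f, CauchySeq fun n => T (g f n) := fun f => by
    refine cauchySeq_of_le_tendsto_0 (fun N : ℕ => 2 * (1 / ((N : ℝ) + 1)) * T (χ f))
      (fun n m N hn hm => ?_) ?_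
    · rw [Real.dist_eq]
      refine hest (hg f n) (hg f m) (hχ f) (hχ0 f) fun x => ?_
      calc |g f n x - g f m x| ≤ |g f n x - f x| + |f x - g f m x| := abs_sub_le _ _ _
        _ ≤ 1 / ((n : ℝ) + 1) * χ f x + 1 / ((m : ℝ) + 1) * χ f x := by
            rw [abs_sub_comm]; exact add_le_add (hfg f n x) (hfg f m x)
        _ ≤ 1 / ((N : ℝ) + 1) * χ f x + 1 / ((N : ℝ) + 1) * χ f x :=
            add_le_add (mul_le_mul_of_nonneg_right (he_anti hn) (hχ0 f x))
              (mul_le_mul_of_nonneg_right (he_anti hm) (hχ0 f x))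
        _ = 2 * (1 / ((N : ℝ) + 1)) * χ f x := by ring
    · have h := (he0.const_mul 2).mul_const (T (χ f))
      rwa [mul_zero, zero_mul] at h
  choose Λ₀ hΛ₀ using fun f => cauchySeq_tendsto_of_complete (hcauchy f)
  -- any dominated approximating sequence from `𝓓` has `T`-values converging to `Λ₀ f`
  have hlim : ∀ (f : C_c(Y, ℝ)) (g' : ℕ → C_c(Y, ℝ)) (χ' : C_c(Y, ℝ)), (∀ n, g' n ∈ 𝓓) → χ' ∈ 𝓓 →
      (∀ x, 0 ≤ χ' x) → (∀ n x, |f x - g' n x| ≤ 1 / ((n : ℝ) + 1) * χ' x) →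
      Tendsto (fun n => T (g' n)) atTop (𝓝 (Λ₀ f)) := by
    intro f g' χ' hg' hχ' hχ'0 hfg'
    have hb : ∀ n, |T (g f n) - T (g' n)| ≤ 1 / ((n : ℝ) + 1) * T (χ f + χ') := fun n =>
      hest (hg f n) (hg' n) (hadd _ (hχ f) _ hχ')
        (fun x => add_nonneg (hχ0 f x) (hχ'0 x)) fun x => by
        calc |g f n x - g' n x| ≤ |g f n x - f x| + |f x - g' n x| := abs_sub_le _ _ _
          _ ≤ 1 / ((n : ℝ) + 1) * χ f x + 1 / ((n : ℝ) + 1) * χ' x := by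
              rw [abs_sub_comm]; exact add_le_add (hfg f n x) (hfg' n x)
          _ = 1 / ((n : ℝ) + 1) * (χ f + χ') x := by
              rw [CompactlySupportedContinuousMap.add_apply]; ring
    have h0 : Tendsto (fun n => T (g f n) - T (g' n)) atTop (𝓝 0) := by
      have h := he0.mul_const (T (χ f + χ'))
      rw [zero_mul] at h
      exact squeeze_zero_norm (fun n => by rw [Real.norm_eq_abs]; exact hb n) h
    have h := (hΛ₀ f).sub h0
    simpa only [sub_sub_cancel, sub_zero] using h
  -- consequences: extension, additivity, positivity
  have hext : ∀ f ∈ 𝓓, Λ₀ f = T f := fun f hf =>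
    tendsto_nhds_unique (hlim f (fun _ => f) (χ f) (fun _ => hf) (hχ f) (hχ0 f) fun n x => by
      rw [sub_self, abs_zero]; exact mul_nonneg (by positivity) (hχ0 f x)) tendsto_const_nhds
  have hΛadd : ∀ f₁ f₂, Λ₀ (f₁ + f₂) = Λ₀ f₁ + Λ₀ f₂ := fun f₁ f₂ => by
    have h := hlim (f₁ + f₂) (fun n => g f₁ n + g f₂ n) (χ f₁ + χ f₂)
      (fun n => hadd _ (hg f₁ n) _ (hg f₂ n)) (hadd _ (hχ f₁) _ (hχ f₂))
      (fun x => add_nonneg (hχ0 f₁ x) (hχ0 f₂ x)) fun n x => by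
        simp only [CompactlySupportedContinuousMap.add_apply]
        calc |f₁ x + f₂ x - (g f₁ n x + g f₂ n x)|
            = |(f₁ x - g f₁ n x) + (f₂ x - g f₂ n x)| := by congr 1; ring
          _ ≤ |f₁ x - g f₁ n x| + |f₂ x - g f₂ n x| := abs_add_le _ _
          _ ≤ 1 / ((n : ℝ) + 1) * χ f₁ x + 1 / ((n : ℝ) + 1) * χ f₂ x :=
              add_le_add (hfg f₁ n x) (hfg f₂ n x)
          _ = 1 / ((n : ℝ) + 1) * (χ f₁ x + χ f₂ x) := by ring
    have h' : Tendsto (fun n => T (g f₁ n + g f₂ n)) atTop (𝓝 (Λ₀ f₁ + Λ₀ f₂)) :=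
      ((hΛ₀ f₁).add (hΛ₀ f₂)).congr fun n => (hTadd _ (hg f₁ n) _ (hg f₂ n)).symm
    exact tendsto_nhds_unique h h'
  have hΛpos : ∀ f, (∀ x, 0 ≤ f x) → 0 ≤ Λ₀ f := fun f hf0 => by
    have hcast : ∀ n : ℕ, (((n + 1 : ℚ)⁻¹ : ℚ) : ℝ) = 1 / ((n : ℝ) + 1) := fun n => by
      push_cast; ring
    have h1 : ∀ n, 0 ≤ T (g f n) + 1 / ((n : ℝ) + 1) * T (χ f) := fun n => by
      have hmem := hsmul ((n + 1 : ℚ)⁻¹) (χ f) (hχ f)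
      have h := hTpos _ (hadd _ (hg f n) _ hmem) fun x => by
        rw [CompactlySupportedContinuousMap.add_apply, CompactlySupportedContinuousMap.smul_apply,
          smul_eq_mul, hcast]
        have hx := (abs_le.mp (hfg f n x)).2
        linarith [hf0 x]
      rwa [hTadd _ (hg f n) _ hmem, hThom _ _ (hχ f), hcast] at h
    have h2 : Tendsto (fun n => T (g f n) + 1 / ((n : ℝ) + 1) * T (χ f)) atTop (𝓝 (Λ₀ f)) := by
      have h := (hΛ₀ f).add (he0.mul_const (T (χ f)))
      rwa [zero_mul, add_zero] at h
    exact ge_of_tendsto' h2 h1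
  obtain ⟨Λ, hΛ⟩ := exists_positiveLinearMap_of_additive_of_nonneg Λ₀ hΛadd hΛpos
  exact ⟨Λ, fun f hf => (hΛ f).trans (hext f hf)⟩

end Extension

section Measure

variable [T2Space Y] [LocallyCompactSpace Y] [MeasurableSpace Y] [BorelSpace Y]
  {𝓓 : Set C_c(Y, ℝ)} {T : C_c(Y, ℝ) → ℝ}

/-- **Riesz–Markov representation of a positive `ℚ`-linear functional on a dominated-dense test
family.**  On a locally compact `T2` Borel space `Y`, let `𝓓 ⊆ C_c(Y, ℝ)` be closed under `+`
and rational multiples and dominated-dense, and let `T` be additive, `ℚ`-homogeneous and positive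
on `𝓓`.  Then there is a regular Borel measure `m` on `Y` (in particular finite on compact sets)
with `∫ f dm = T f` for every `f ∈ 𝓓` (extend `T` to a positive linear functional,
`exists_positiveLinearMap_eq_on_dominatedDense`, and apply the Riesz–Markov–Kakutani theorem,
Mathlib's `RealRMK.integral_rieszMeasure`). [cite: Rudin1987, Thm. 2.14] -/
theorem exists_regular_measure_integral_eq_on_dominatedDense
    (hadd : ∀ f ∈ 𝓓, ∀ g ∈ 𝓓, f + g ∈ 𝓓) (hsmul : ∀ (q : ℚ), ∀ f ∈ 𝓓, (q : ℝ) • f ∈ 𝓓)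
    (hdense : ∀ K : Set Y, IsCompact K → ∃ χ ∈ 𝓓, (∀ x, χ x ∈ Icc (0 : ℝ) 1) ∧ (∀ x ∈ K, χ x = 1) ∧
      ∀ f : C_c(Y, ℝ), support f ⊆ K → ∀ η : ℝ, 0 < η → ∃ g ∈ 𝓓, ∀ x, |f x - g x| ≤ η * χ x)
    (hTadd : ∀ f ∈ 𝓓, ∀ g ∈ 𝓓, T (f + g) = T f + T g)
    (hThom : ∀ (q : ℚ), ∀ f ∈ 𝓓, T ((q : ℝ) • f) = (q : ℝ) * T f)
    (hTpos : ∀ f ∈ 𝓓, (∀ x, 0 ≤ f x) → 0 ≤ T f) :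
    ∃ m : Measure Y, m.Regular ∧ ∀ f ∈ 𝓓, ∫ x, f x ∂m = T f := by
  obtain ⟨Λ, hΛ⟩ :=
    exists_positiveLinearMap_eq_on_dominatedDense hadd hsmul hdense hTadd hThom hTpos
  exact ⟨RealRMK.rieszMeasure Λ, inferInstance, fun f hf => by
    rw [RealRMK.integral_rieszMeasure, hΛ f hf]⟩

end Measure

end Literature.Probability.Distributions

end
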